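import Summits.BirchSwinnertonDyer.Rank1Residual.F1Sign2.BranchCongruenceModTwoAtTwo
import HarnessLib

/-!
# F1Sign2 / MultiplicativeAtTwoRepaired — REPAIRED curve-level readings at a multiplicative `2`
(cell `bsd-f1-sign2`, seat `-imc` g1, planner-of-record; STATEMENT file, companion of
`BranchCongruenceModTwoAtTwo.lean` p543248 and `OddEvenCongruenceMultAtTwo.lean` p539019)

TURNKEY filing by the typer seat `bsd-f1-sign2-ty` (INBOX 2026-08-27T16:08:15Z, T-imc-4a): the planner's
`HOME/MEMO-imc-data/F1Sign2MultRepaired.lean` sha16 af9db7ffa5e4cf94 (standalone farm check rc 0, 0 warnings,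
0 sorries) re-filed VERBATIM; REF1 g2 batch 6 audits the refutation-of-record of the as-typed decls and these
repaired `…R` decls (CANDIDATES.md §2 rows IMC-B / IMC-K2μ carry the verdict lines). PARTITION: none moved.

AUDIT FINDING (2026-08-27, -imc g1). The tree's `WeierstrassCurve.frobeniusTrace W p = p + 1 − #Ẽ(𝔽_p)`
equals `a_p(E) + 1 ∈ {0, 2}` at a prime of MULTIPLICATIVE reduction
(`WeierstrassCurve.LFunction_apply_prime_eq_frobeniusTrace_sub_one_of_hasMultiplicativeReductionAtPrime`,
`…_of_hasSplitMultiplicativeReductionAtPrime : W.LFunction p = 1`,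
`…_of_hasMultiplicativeReductionAtPrime_of_not_split : W.LFunction p = -1`), whereas the allowable root of
the one-term (`ε(2) = 0`) Mazur–Tate–Teitelbaum measure is `α = a₂(E) = W.LFunction 2 = ±1`. Hence the
four curve-level multiplicative readings typed over `(W.frobeniusTrace 2 : ℚ_[2])` —
`MultBranchCongruenceAtTwo`, `AnalyticMuZeroMultAtTwo`, the `hu` binder of
`oddEvenCongruenceMult_of_modTwo_of_muZero` (p543248) and `OddEvenCongruenceMultAtTwo` (p539019) — are
junk-typed: at a non-split `2` their `α` is `0`, the one-term measures vanish identically, so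
`MultBranchCongruenceAtTwo` holds trivially there and `AnalyticMuZeroMultAtTwo` is refuted by any modular
non-split curve (kernel certificates: `RhombicBranchCongruenceHolds.lean` §D); class `misstated`. They are
left in place as settled junk edges (never re-worded in place); this file files the REPAIRED readings with
`α := ((W.LFunction 2 : ℤ) : ℚ_[2])` under new names `…R`, plus the proved glue (package uniqueness stays a displayed,
uncredited hypothesis `hu`, as in p543248). The newform-level conjecture `RhombicBranchCongruence`
(p543248, over `cuspCoeff f 2 = a₂`) was correctly typed and is PROVED in `RhombicBranchCongruenceHolds.lean`,
which also proves `RhombicOfNegDisc → MultBranchCongruenceAtTwoR`.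
Sources: [cite: MazurTateTeitelbaum1986Invent, §I.10–§I.14] (one-term measure at `p ∥ N`, allowable root
`α = a_p`); [cite: GreenbergLNM1716, §4] (`(1 − α⁻¹)`, non-split factor 2); [cite: Greenberg1999, Conj. 1.11]
(`μ = 0` when `E[p]` is irreducible; at `p = 2`: no rational `2`-torsion); [cite: Matsuno2008, Thm 5.1]
(algebraic Kida-type twin of the odd/even comparison at `2`). No novelty claim for the statements; the
placement register is HOME/REF2-PLACEMENT-v4.md.
-/

set_option autoImplicit false

noncomputable section

open scoped Classical MatrixGroups ModularForm
open CongruenceSubgroup Polynomial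
open Literature.NumberTheory.EllipticCurves Literature.NumberTheory.EllipticCurves.ModularForms
open Literature.NumberTheory.EllipticCurves.Greenberg1999
open Literature.NumberTheory.EllipticCurves.Rank1Residual
open Summit.BirchSwinnertonDyer.Rank1Residual.X1.MuLambda
open Summit.BirchSwinnertonDyer.Rank1Residual.X5

namespace Summit.BirchSwinnertonDyer.Rank1Residual.F1Sign2

/-! ## §R. REPAIRED curve-level multiplicative readings (audit 2026-08-27, seat `-imc` g1)

The curve-level multiplicative Props of `BranchCongruenceModTwoAtTwo.lean` (p543248:
`MultBranchCongruenceAtTwo`, `AnalyticMuZeroMultAtTwo`, the `hu` hypothesis of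
`oddEvenCongruenceMult_of_modTwo_of_muZero`) and of `OddEvenCongruenceMultAtTwo.lean` (p539019:
`OddEvenCongruenceMultAtTwo`) take the allowable root `α` to be `(W.frobeniusTrace 2 : ℚ_[2])`. In the
tree's currency `frobeniusTrace W p = p + 1 − #Ẽ_ns(𝔽_p)` is `a_p(E) + 1 ∈ {0, 2}` at a MULTIPLICATIVE
prime (`WeierstrassCurve.LFunction_apply_prime_eq_frobeniusTrace_sub_one_of_hasMultiplicativeReductionAtPrime`),
not `a_p(E) = W.LFunction p ∈ {±1}`; so those four readings are junk-typed (trivial at a non-split `2`,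
where `α = 0` kills the one-term measures; see §D for the kernel certificates) — class `misstated`.
The repaired readings below use `α = a₂(E) = W.LFunction 2` (the Hasse–Weil coefficient, which IS
`cuspCoeff f 2` for the newform of `E`: `IsNewformOf`). The newform-level `RhombicBranchCongruence`
(p543248, typed over `cuspCoeff f 2 = a₂`) was correctly typed and is PROVED in §C. -/

/-- **Curve-level A♮L at a multiplicative `2`, REPAIRED currency** (`α = a₂(E) = W.LFunction 2 = ±1`):
`Δ < 0`, no rational `2`-torsion ⇒ `L₂⁺(E,ω⁰) ≡ L₂⁻(E,ω¹) (mod 2Λ₂)` for the one-term (`ε(2) = 0`)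
measures. Follows from `RhombicOfNegDisc` (`multBranchCongruenceAtTwoR_of_rhombicOfNegDisc`). [folklore] -/
@[conjecture] def MultBranchCongruenceAtTwoR : Prop :=
  ∀ (W : WeierstrassCurve ℚ) [W.IsElliptic] [W.IsGloballyMinimal],
    W.HasMultiplicativeReductionAtPrime 2 → W.Δ < 0 → (∀ x : ℚ, ¬ HasRationalTwoTorsionX W x) →
    ∀ ⦃N : ℕ⦄ [NeZero N] (f : CuspForm (Gamma0 N) 2), IsNewformOf W f →
      BranchCongruenceModTwoMult f ((W.LFunction 2 : ℤ) : ℚ_[2])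

/-- **K2μ at a multiplicative `2`, REPAIRED currency** (THE open input on the multiplicative rows):
analytic `μ = 0` of the even one-term branch `L₂⁺(E, a₂, ω⁰, T)` when `E(ℚ)[2] = 0`.
[cite: Greenberg1999, Conj. 1.11 (posed for all p; the p = 2 multiplicative analytic reading is ours)] -/
@[conjecture] def AnalyticMuZeroMultAtTwoR : Prop :=
  ∀ (W : WeierstrassCurve ℚ) [W.IsElliptic] [W.IsGloballyMinimal],
    W.HasMultiplicativeReductionAtPrime 2 → (∀ x : ℚ, ¬ HasRationalTwoTorsionX W x) →
    ∀ ⦃N : ℕ⦄ [NeZero N] (f : CuspForm (Gamma0 N) 2), IsNewformOf W f →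
    ∀ G : IwasawaAlgebra 2,
      iwasawaToPowerSeries 2 G = padicLFunctionPlusBranchMult f ((W.LFunction 2 : ℤ) : ℚ_[2]) 0 →
      red G ≠ 0

/-- **Candidate IMC-B at a multiplicative `2`, REPAIRED currency** (replaces `OddEvenCongruenceMultAtTwo`,
p539019, whose `α = frobeniusTrace 2 ∈ {0,2}` makes the package hypothesis junk): the even and `ω`-odd
`2`-adic `L`-functions of `E` (multiplicative at `2`, `Δ < 0`, no rational `2`-torsion) agree in `𝔽₂⟦T⟧`
after stripping `2`-powers. [folklore] -/
@[conjecture] def OddEvenCongruenceMultAtTwoR : Prop :=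
  ∀ (W : WeierstrassCurve ℚ) [W.IsElliptic] [W.IsGloballyMinimal],
    W.HasMultiplicativeReductionAtPrime 2 → W.Δ < 0 → (∀ x : ℚ, ¬ HasRationalTwoTorsionX W x) →
    ∀ ⦃N : ℕ⦄ [NeZero N] (f : CuspForm (Gamma0 N) 2), IsNewformOf W f →
      CongruentBranchesMult f ((W.LFunction 2 : ℤ) : ℚ_[2])

/-- Glue (proved), repaired currency: `MultBranchCongruenceAtTwoR ∧ AnalyticMuZeroMultAtTwoR ∧ hu ⇒
OddEvenCongruenceMultAtTwoR` (`congruentBranchesMult_of_modTwo` is generic in `α`). The DISPLAYED hypothesis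
`hu` (package uniqueness in the repaired currency, in print — not a conjecture, not credited): every `2`-adic
multiplicative package `IsMultPAdicLFunctionOf f 2 a₂ Lp` (`a₂ = W.LFunction 2 = ±1`) IS the one-term even
branch `L₂⁺(f, a₂, ω⁰, T)` — interpolation property of the one-term measure at the even characters of
`2`-power conductor and order, plus uniqueness of an element of `Λ₂ ⊗ ℚ` with prescribed values at the
infinitely many points `χ(5) − 1` (Weierstrass preparation) [cite: MazurTateTeitelbaum1986Invent, §I.13–§I.14]
[cite: Washington1997, Thm 7.3, Cor 7.4]. [folklore] -/
theorem oddEvenCongruenceMultR_of_modTwo_of_muZero (h₁ : MultBranchCongruenceAtTwoR)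
    (h₂ : AnalyticMuZeroMultAtTwoR)
    (hu : ∀ (W : WeierstrassCurve ℚ) [W.IsElliptic] [W.IsGloballyMinimal],
      W.HasMultiplicativeReductionAtPrime 2 → ∀ ⦃N : ℕ⦄ [NeZero N] (f : CuspForm (Gamma0 N) 2),
      IsNewformOf W f → MultPackageIsPlusBranch f ((W.LFunction 2 : ℤ) : ℚ_[2])) :
    OddEvenCongruenceMultAtTwoR := by
  intro W _ _ hmult hΔ h2 N _ f hf
  exact congruentBranchesMult_of_modTwo f _ (h₁ W hmult hΔ h2 f hf) (h₂ W hmult h2 f hf) (hu W hmult f hf)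


end Summit.BirchSwinnertonDyer.Rank1Residual.F1Sign2
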